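import Summits.Ventures.LatticeQCDFlow.Scaling.ProductRefreshCeiling

/-!
HONEST FRAMING: exact (Metropolis-corrected) sampling algorithms for lattice gauge theory; figures
of merit are autocorrelation/cost numbers at stated couplings and volumes; no continuum-physics
claim.

# ProductRefreshStaleStructure — THE EXACT-REDRAW PRODUCT CHAIN (RANDOM-SCAN GIBBS SAMPLER OF A PRODUCT LAW `⊗μ_k` ON `S^d`) SEEN THROUGH ITS STALE SET: FROM `x`, STALE COORDINATES
# SHOW `x`; A WEIGHT FRESH-EXCHANGEABLE OFF `D` (`ρ(z[k↦v])μ_k(z_k) = ρ(z)μ_k(v)`, `k ∉ D` — CHAPTER L FILE R2's PROPERTY OF THE AUGMENTED LAW, AND OF `⊗μ_k` WITH `D = ∅`) MAKES EVERY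
# CLEAN COORDINATE `k` EXACTLY `μ_k`-DISTRIBUTED GIVEN THE OTHERS: THE NUMBER OF CLEAN COORDINATES AGREEING WITH `x` HAS MEAN `Σ_{k∉D}μ_k(x_k)` AND SQUARE DEVIATION `Σ_{k∉D}μ_k(x_k)(1−μ_k(x_k))`
# (lean-2 GEN-45, ours)

Venture-side (OURS).  Cell `lqcd-flow` (pub-lqcd), unit `pub-lqcd-lean-2-g45`, 2026-08-31.  Chapter AE, file 13 — file 6 for the product refresh chain of chapter L files R1 ∕ R2
(`Scaling/ProductRefreshAugmentation`, `Scaling/ProductRefreshCeiling`: `prodKernel w M` with exact redraws `M_k(u,·) = μ_k`, the augmented chain on (configuration, stale set) by the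
hypothesis-equation `hPh`, stale coordinate `k` cleaned with probability `w_k` per step), with coordinate-dependent laws `μ_k`: the structure behind file 14's law-free `½·log d` floor
(the hypercube ∕ Ehrenfest-urn lower bound of Levin–Peres–Wilmer Prop. 7.14 for every product target).

* §1 **`refresh_lawAt_stale`** — from `δ_{(x, univ)}`: `λ_n(z, D) ≠ 0 ⇒ z_k = x_k` for every `k ∈ D`.
* §2 `pfresh_point`, `psum_filter_update`, **`pfresh_coord_indicator`** (`Σ_w 𝟙{w_k = v}ρ(w)g(w) = μ_k(v)Σρg`, `g` blind to `k ∉ D`).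
* §3 the clean match-count `B_D(z) = Σ_{k∉D}𝟙{z_k = x_k}`: **`pfresh_match_mean`** (`Σρ·B_D = (Σ_{k∉D}μ_k(x_k))·Σρ`), `pfresh_match_pair`, **`pfresh_match_sqdev`**
  (`Σρ·(B_D − Σ_{k∉D}μ_k(x_k))² = (Σ_{k∉D}μ_k(x_k)(1−μ_k(x_k)))·Σρ`), **`pfresh_match_chebyshev`**.

Literature grade (cell rule): OWN, elementary (second-moment method); nothing cited as a fact; no new bib keys.
-/

noncomputable section

open Finset Function
open Literature.Probability.MarkovChains

namespace Summit.Ventures.LatticeQCDFlow.Scaling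

/-! ## §1 Stale coordinates show the start -/

section Support
variable {S : Type*} [Fintype S] [DecidableEq S] {d : ℕ} {μ : Fin d → S → ℝ} {M : Fin d → S → S → ℝ} {w : Fin d → ℝ}

/-- **FROM `x`, STALE COORDINATES SHOW `x`:** `λ_n(z, D) ≠ 0 ⇒ ∀ k ∈ D, z_k = x_k` for the augmented refresh chain started at `(x, univ)`. [ours] -/
theorem refresh_lawAt_stale
    {Ph : (Fin d → S) × Finset (Fin d) → (Fin d → S) × Finset (Fin d) → ℝ}
    (hPh : ∀ p q, Ph p q = ∑ k : Fin d, w k * (coordKernel M k p.1 q.1 * (if q.2 = p.2 \ {k} then (1 : ℝ) else 0)))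
    (x : Fin d → S) : ∀ (n : ℕ) (z : Fin d → S) (D : Finset (Fin d)),
      lawAt Ph (Pi.single (x, (univ : Finset (Fin d))) 1) n (z, D) ≠ 0 → ∀ k ∈ D, z k = x k := by
  intro n
  induction n with
  | zero =>
      intro z D h k _
      rw [lawAt_zero] at h
      by_cases hz : ((z, D) : (Fin d → S) × Finset (Fin d)) = (x, (univ : Finset (Fin d)))
      · have := congrArg Prod.fst hz
        exact congrFun this k
      · exact absurd (by rw [Pi.single_apply, if_neg hz]) h
  | succ n ih =>
      intro z' D' h k hk
      rw [lawAt_succ, refresh_stepLaw_apply hPh] at h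
      by_contra hne
      apply h
      refine sum_eq_zero fun j _ => ?_
      rw [sum_eq_zero fun D hD => ?_, mul_zero]
      refine sum_eq_zero fun u' _ => ?_
      have hD' : D \ ({j} : Finset (Fin d)) = D' := (mem_filter.mp hD).2
      by_cases hr : lawAt Ph (Pi.single (x, (univ : Finset (Fin d))) 1) n (update z' j u', D) = 0
      · rw [hr, zero_mul]
      · exfalso
        have hkD : k ∈ D := by rw [← hD'] at hk; exact (mem_sdiff.mp hk).1
        have hkj : k ≠ j := by rw [← hD'] at hk; exact fun e => (mem_sdiff.mp hk).2 (by rw [e]; exact mem_singleton_self _)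
        have := ih _ _ hr _ hkD
        rw [update_of_ne hkj] at this
        exact hne this

end Support

/-! ## §2 A fresh-exchangeable weight: every clean coordinate `k` is `μ_k` given the others -/

section Fresh
variable {S : Type*} [Fintype S] [DecidableEq S] {d : ℕ} {μ : Fin d → S → ℝ} {ρ : (Fin d → S) → ℝ} {D : Finset (Fin d)}

omit [Fintype S] [DecidableEq S] in
/-- **Pointwise:** `w_k = v`, `k ∉ D` ⇒ `ρ(w)·μ_k(a) = ρ(w[k↦a])·μ_k(v)`. [ours] -/
theorem pfresh_point [DecidableEq S] (hρ : ∀ (z : Fin d → S) (k : Fin d) (v : S), k ∉ D → ρ (update z k v) * μ k (z k) = ρ z * μ k v)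
    {k : Fin d} (hk : k ∉ D) {w : Fin d → S} {v : S} (hw : w k = v) (a : S) : ρ w * μ k a = ρ (update w k a) * μ k v := by
  have h := hρ (update w k a) k (w k) hk
  rw [update_idem, update_eq_self, update_self, hw] at h
  exact h

omit [Fintype S] in
/-- **The bijection `w ↦ w[k↦a]` between `{w_k = v}` and `{z_k = a}`:** `Σ_w 𝟙{w_k = v}·G(w[k↦a]) = Σ_z 𝟙{z_k = a}·G(z)`. [ours] -/
theorem psum_filter_update [Fintype S] (G : (Fin d → S) → ℝ) (k : Fin d) (v a : S) :
    ∑ w ∈ univ.filter (fun w : Fin d → S => w k = v), G (update w k a) = ∑ z ∈ univ.filter (fun z : Fin d → S => z k = a), G z := by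
  refine Finset.sum_nbij' (fun w => update w k a) (fun z => update z k v) ?_ ?_ ?_ ?_ ?_
  · intro w _; exact mem_filter.mpr ⟨mem_univ _, by rw [update_self]⟩
  · intro z _; exact mem_filter.mpr ⟨mem_univ _, by rw [update_self]⟩
  · intro w hw
    have hwk : w k = v := (mem_filter.mp hw).2
    rw [update_idem, ← hwk, update_eq_self]
  · intro z hz
    have hzk : z k = a := (mem_filter.mp hz).2
    rw [update_idem, ← hzk, update_eq_self]
  · intro w _; rfl

/-- **EVERY CLEAN COORDINATE IS `μ_k` GIVEN THE OTHERS:** for `k ∉ D`, `Σμ_k = 1` and every `g` blind to coordinate `k`, **`Σ_w 𝟙{w_k = v}·ρ(w)·g(w) = μ_k(v)·Σ_z ρ(z)·g(z)`**. [ours] -/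
theorem pfresh_coord_indicator (hρ : ∀ (z : Fin d → S) (k : Fin d) (v : S), k ∉ D → ρ (update z k v) * μ k (z k) = ρ z * μ k v)
    (hμ1 : ∀ k, ∑ a, μ k a = 1) {k : Fin d} (hk : k ∉ D) {g : (Fin d → S) → ℝ} (hg : ∀ z a, g (update z k a) = g z) (v : S) :
    ∑ w, (if w k = v then (1 : ℝ) else 0) * (ρ w * g w) = μ k v * ∑ z, ρ z * g z := by
  classical
  -- `ρ(w) = μ_k(v)·Σ_a ρ(w[k↦a])` on `{w_k = v}`
  have hpt : ∀ w : Fin d → S, w k = v → ρ w = μ k v * ∑ a, ρ (update w k a) := by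
    intro w hw
    have : ρ w * ∑ a, μ k a = ∑ a, ρ (update w k a) * μ k v := by
      rw [mul_sum]; exact sum_congr rfl fun a _ => pfresh_point hρ hk hw a
    rw [hμ1 k, mul_one] at this
    rw [this, ← sum_mul, mul_comm]
  rw [show (∑ w, (if w k = v then (1 : ℝ) else 0) * (ρ w * g w)) = ∑ w ∈ univ.filter (fun w : Fin d → S => w k = v), ρ w * g w by
    rw [Finset.sum_filter]; exact sum_congr rfl fun w _ => by split_ifs <;> simp]
  calc ∑ w ∈ univ.filter (fun w : Fin d → S => w k = v), ρ w * g w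
      = ∑ w ∈ univ.filter (fun w : Fin d → S => w k = v), μ k v * ∑ a, ρ (update w k a) * g (update w k a) := by
        refine sum_congr rfl fun w hw => ?_
        have hwk : w k = v := (mem_filter.mp hw).2
        rw [hpt w hwk, mul_assoc, sum_mul]
        congr 1; exact sum_congr rfl fun a _ => by rw [hg]
    _ = μ k v * ∑ a, ∑ w ∈ univ.filter (fun w : Fin d → S => w k = v), ρ (update w k a) * g (update w k a) := by
        rw [← mul_sum, sum_comm]
    _ = μ k v * ∑ a, ∑ z ∈ univ.filter (fun z : Fin d → S => z k = a), ρ z * g z := by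
        congr 1; exact sum_congr rfl fun a _ => psum_filter_update (fun z => ρ z * g z) k v a
    _ = μ k v * ∑ z, ρ z * g z := by
        congr 1
        rw [← Finset.sum_fiberwise_of_maps_to (s := (univ : Finset (Fin d → S))) (t := (univ : Finset S)) (g := fun z => z k) (fun z _ => mem_univ _)]

/-! ## §3 The clean match-count: mean, square deviation, Chebyshev -/

/-- **THE MEAN:** `Σ_z ρ(z)·B_D(z) = (Σ_{k∉D}μ_k(x_k))·Σ_z ρ(z)`, `B_D(z) = Σ_{k∉D} 𝟙{z_k = x_k}`. [ours] -/
theorem pfresh_match_mean (hρ : ∀ (z : Fin d → S) (k : Fin d) (v : S), k ∉ D → ρ (update z k v) * μ k (z k) = ρ z * μ k v)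
    (hμ1 : ∀ k, ∑ a, μ k a = 1) (x : Fin d → S) :
    ∑ z, ρ z * ∑ k ∈ univ \ D, (if z k = x k then (1 : ℝ) else 0) = (∑ k ∈ univ \ D, μ k (x k)) * ∑ z, ρ z := by
  classical
  rw [show (∑ z, ρ z * ∑ k ∈ univ \ D, (if z k = x k then (1 : ℝ) else 0)) = ∑ k ∈ univ \ D, ∑ z, (if z k = x k then (1 : ℝ) else 0) * (ρ z * 1) by
    rw [sum_comm]; exact sum_congr rfl fun z _ => by rw [mul_sum]; exact sum_congr rfl fun k _ => by ring]
  rw [sum_congr rfl fun k hk => pfresh_coord_indicator hρ hμ1 (Finset.mem_sdiff.mp hk).2 (g := fun _ => (1 : ℝ)) (fun _ _ => rfl) (x k), sum_mul]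
  simp only [mul_one]

/-- **THE PAIR CORRELATIONS:** for `k, l ∉ D`: `Σ_z ρ𝟙{z_k = x_k}𝟙{z_l = x_l} = μ_k(x_k)·Σρ` if `k = l`, `= μ_k(x_k)μ_l(x_l)·Σρ` if `k ≠ l`. [ours] -/
theorem pfresh_match_pair (hρ : ∀ (z : Fin d → S) (k : Fin d) (v : S), k ∉ D → ρ (update z k v) * μ k (z k) = ρ z * μ k v)
    (hμ1 : ∀ k, ∑ a, μ k a = 1) (x : Fin d → S) {k l : Fin d} (hk : k ∉ D) (hl : l ∉ D) :
    ∑ z, ρ z * ((if z k = x k then (1 : ℝ) else 0) * (if z l = x l then (1 : ℝ) else 0)) = (if k = l then μ k (x k) else μ k (x k) * μ l (x l)) * ∑ z, ρ z := by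
  classical
  by_cases hkl : k = l
  · subst hkl
    rw [if_pos rfl]
    have e : ∀ z : Fin d → S, ρ z * ((if z k = x k then (1 : ℝ) else 0) * (if z k = x k then (1 : ℝ) else 0)) = (if z k = x k then (1 : ℝ) else 0) * (ρ z * 1) := by
      intro z; split_ifs <;> ring
    rw [sum_congr rfl fun z _ => e z, pfresh_coord_indicator hρ hμ1 hk (g := fun _ => (1 : ℝ)) (fun _ _ => rfl) (x k)]
    simp only [mul_one]
  · rw [if_neg hkl]
    have e : ∀ z : Fin d → S, ρ z * ((if z k = x k then (1 : ℝ) else 0) * (if z l = x l then (1 : ℝ) else 0)) = (if z k = x k then (1 : ℝ) else 0) * (ρ z * (if z l = x l then (1 : ℝ) else 0)) := by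
      intro z; ring
    rw [sum_congr rfl fun z _ => e z, pfresh_coord_indicator hρ hμ1 hk (g := fun z => if z l = x l then (1 : ℝ) else 0) (fun z a => by rw [update_of_ne (Ne.symm hkl)]) (x k)]
    have e2 : ∀ z : Fin d → S, ρ z * (if z l = x l then (1 : ℝ) else 0) = (if z l = x l then (1 : ℝ) else 0) * (ρ z * 1) := by intro z; ring
    rw [sum_congr rfl fun z _ => e2 z, pfresh_coord_indicator hρ hμ1 hl (g := fun _ => (1 : ℝ)) (fun _ _ => rfl) (x l)]
    simp only [mul_one]; ring

/-- **THE SQUARE DEVIATION:** `Σ_z ρ(z)·(B_D(z) − Σ_{k∉D}μ_k(x_k))² = (Σ_{k∉D} μ_k(x_k)(1−μ_k(x_k)))·Σ_z ρ(z)`. [ours] -/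
theorem pfresh_match_sqdev (hρ : ∀ (z : Fin d → S) (k : Fin d) (v : S), k ∉ D → ρ (update z k v) * μ k (z k) = ρ z * μ k v)
    (hμ1 : ∀ k, ∑ a, μ k a = 1) (x : Fin d → S) :
    ∑ z, ρ z * (∑ k ∈ univ \ D, (if z k = x k then (1 : ℝ) else 0) - ∑ k ∈ univ \ D, μ k (x k)) ^ 2
      = (∑ k ∈ univ \ D, μ k (x k) * (1 - μ k (x k))) * ∑ z, ρ z := by
  classical
  set e : ℝ := ∑ k ∈ univ \ D, μ k (x k) with he
  have hsq : ∀ z : Fin d → S, ρ z * (∑ k ∈ univ \ D, (if z k = x k then (1 : ℝ) else 0) - e) ^ 2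
      = ρ z * (∑ k ∈ univ \ D, ∑ l ∈ univ \ D, (if z k = x k then (1 : ℝ) else 0) * (if z l = x l then (1 : ℝ) else 0))
        - 2 * e * (ρ z * ∑ k ∈ univ \ D, (if z k = x k then (1 : ℝ) else 0)) + e ^ 2 * ρ z := by
    intro z
    rw [sub_sq, sq, Finset.sum_mul_sum]
    ring
  rw [sum_congr rfl fun z _ => hsq z, sum_add_distrib, sum_sub_distrib, ← mul_sum, ← mul_sum, pfresh_match_mean hρ hμ1 x, ← he]
  have hdouble : ∑ z, ρ z * ∑ k ∈ univ \ D, ∑ l ∈ univ \ D, (if z k = x k then (1 : ℝ) else 0) * (if z l = x l then (1 : ℝ) else 0)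
      = (e ^ 2 + ∑ k ∈ univ \ D, (μ k (x k) - μ k (x k) ^ 2)) * ∑ z, ρ z := by
    have hswap : ∑ z, ρ z * ∑ k ∈ univ \ D, ∑ l ∈ univ \ D, (if z k = x k then (1 : ℝ) else 0) * (if z l = x l then (1 : ℝ) else 0)
        = ∑ k ∈ univ \ D, ∑ l ∈ univ \ D, ∑ z, ρ z * ((if z k = x k then (1 : ℝ) else 0) * (if z l = x l then (1 : ℝ) else 0)) := by
      simp_rw [mul_sum]
      rw [sum_comm]
      refine sum_congr rfl fun k _ => ?_
      rw [sum_comm]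
    rw [hswap, sum_congr rfl fun k hk => sum_congr rfl fun l hl => pfresh_match_pair hρ hμ1 x (Finset.mem_sdiff.mp hk).2 (Finset.mem_sdiff.mp hl).2]
    simp_rw [← sum_mul]
    congr 1
    have hinner : ∀ k ∈ univ \ D, ∑ l ∈ univ \ D, (if k = l then μ k (x k) else μ k (x k) * μ l (x l)) = μ k (x k) * e + (μ k (x k) - μ k (x k) ^ 2) := by
      intro k hk
      have e1 : ∀ l ∈ univ \ D, (if k = l then μ k (x k) else μ k (x k) * μ l (x l)) = μ k (x k) * μ l (x l) + (if k = l then μ k (x k) - μ k (x k) * μ l (x l) else 0) := by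
        intro l _; split_ifs <;> ring
      rw [sum_congr rfl e1, sum_add_distrib, ← mul_sum, ← he, Finset.sum_ite_eq (univ \ D) k, if_pos hk]
      ring
    rw [sum_congr rfl hinner, sum_add_distrib, ← sum_mul, ← he]
    ring
  rw [hdouble]
  have : ∑ k ∈ univ \ D, μ k (x k) * (1 - μ k (x k)) = ∑ k ∈ univ \ D, (μ k (x k) - μ k (x k) ^ 2) := sum_congr rfl fun k _ => by ring
  rw [this]
  ring

/-- **CHEBYSHEV FOR THE CLEAN MATCH-COUNT:** `ρ ≥ 0`, `c > 0` ⇒ `Σ_{z : (B_D(z) − Σ_{k∉D}μ_k(x_k))² ≥ c} ρ(z) ≤ ((Σ_{k∉D}μ_k(x_k)(1−μ_k(x_k)))/c)·Σρ`. [ours] -/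
theorem pfresh_match_chebyshev (hρ : ∀ (z : Fin d → S) (k : Fin d) (v : S), k ∉ D → ρ (update z k v) * μ k (z k) = ρ z * μ k v)
    (hρ0 : ∀ z, 0 ≤ ρ z) (hμ1 : ∀ k, ∑ a, μ k a = 1) (x : Fin d → S) {c : ℝ} (hc : 0 < c) :
    ∑ z ∈ univ.filter (fun z : Fin d → S => c ≤ (∑ k ∈ univ \ D, (if z k = x k then (1 : ℝ) else 0) - ∑ k ∈ univ \ D, μ k (x k)) ^ 2), ρ z
      ≤ (∑ k ∈ univ \ D, μ k (x k) * (1 - μ k (x k))) / c * ∑ z, ρ z := by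
  classical
  rw [div_mul_eq_mul_div, le_div_iff₀ hc, ← pfresh_match_sqdev hρ hμ1 x]
  calc (∑ z ∈ univ.filter (fun z : Fin d → S => c ≤ (∑ k ∈ univ \ D, (if z k = x k then (1 : ℝ) else 0) - ∑ k ∈ univ \ D, μ k (x k)) ^ 2), ρ z) * c
      = ∑ z ∈ univ.filter (fun z : Fin d → S => c ≤ (∑ k ∈ univ \ D, (if z k = x k then (1 : ℝ) else 0) - ∑ k ∈ univ \ D, μ k (x k)) ^ 2), ρ z * c := sum_mul _ _ _
    _ ≤ ∑ z ∈ univ.filter (fun z : Fin d → S => c ≤ (∑ k ∈ univ \ D, (if z k = x k then (1 : ℝ) else 0) - ∑ k ∈ univ \ D, μ k (x k)) ^ 2),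
          ρ z * (∑ k ∈ univ \ D, (if z k = x k then (1 : ℝ) else 0) - ∑ k ∈ univ \ D, μ k (x k)) ^ 2 :=
        sum_le_sum fun z hz => mul_le_mul_of_nonneg_left (mem_filter.mp hz).2 (hρ0 z)
    _ ≤ ∑ z, ρ z * (∑ k ∈ univ \ D, (if z k = x k then (1 : ℝ) else 0) - ∑ k ∈ univ \ D, μ k (x k)) ^ 2 :=
        sum_le_sum_of_subset_of_nonneg (filter_subset _ _) fun z _ _ => mul_nonneg (hρ0 z) (sq_nonneg _)

end Fresh

end Summit.Ventures.LatticeQCDFlow.Scaling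

end
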